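import Literature.NumberTheory.Automorphic.HidaLevelDegreeZeroShift
import Literature.NumberTheory.Automorphic.LevelControlDegreeZero
import Literature.NumberTheory.Automorphic.LevelControlFiniteLevel
import Literature.NumberTheory.Automorphic.HidaTowerDegreeZeroOrdinary
import Literature.NumberTheory.Automorphic.HidaTowerLevelActionBridge
import Literature.NumberTheory.Automorphic.LevelActionHeckeMultiplicative
import HarnessLib

/-!
# `U_{v,1}` is nilpotent on `H⁰` with trivial `ℤ/p^s`-coefficients

Topic `NumberTheory/Automorphic`; namespace `Literature.NumberTheory.Automorphic.BigHeckeGLn.TameLevel`;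
theorems only; no named fact, no `sorry`.

`GL₂` over a number field `K`, tame level `U` maximal above `p`, `v ∣ p`, a Hida level
`U' = U(b', c)` (`b' ≤ c`, `1 ≤ c`) with its normal subgroup `U(c, c)` and finite quotient `Q`.
For every `Q`-module `N` and the induced coefficient system `𝓕(N) = M(U', N ⊗ ℤ/p^s)` with TRIVIAL
action on `ℤ/p^s`, the `U_p`-type operator `U = ∑_j (N(x_j) t_v)` of the unipotent family satisfies
**`U^n = 0` on `H⁰(Γ, 𝓕(N))` for `n ≥ s`** (`inducedHeckeCohomology_zero_pow_eq_zero_triv`): by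
`LevelControlDegreeZero` it suffices that invariant sections take equal values at all `g N(x_j) t`
(`apply_mul_unipotentFamily_eq_of_unipotent_trivial`, the unipotents acting trivially) and that
`B = ∑_j τ(N(x_j) t) = #J · 1` is nilpotent on `ℤ/p^s` — `#J = #(U(c,c) t U(c,c)/U(c,c))` is
divisible by `p` (`dvd_card_doubleCosetQuot_hidaLevel`).  Transported along `M(U', 1) ≅ 𝓕(ℤ)`
(`trivRepIso`): **`[U' t_v U']^n = 0` on `H⁰(U(b',c), 1; ℤ/p^s)`** (`laHecke_zero_pow_eq_zero`).

[cite: Hida1994AIF, §3, proof of Thm 3.2 (e kills H⁰)] [cite: KhareThorne2017, §6.3]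

## References

* H. Hida, Ann. Inst. Fourier 44 (1994), §3. [Hida1994AIF]
* C. Khare, J. A. Thorne, Amer. J. Math. 139 (2017), §6.3. [KhareThorne2017]
-/

noncomputable section

open CategoryTheory IsDedekindDomain groupCohomology
open scoped NumberField TensorProduct

namespace Literature.NumberTheory.Automorphic

namespace BigHeckeGLn

namespace TameLevel

open LevelAction

variable {K : Type} [Field K] [NumberField K] {p : ℕ} [Fact p.Prime] (𝒰 : TameLevel 2 K p)
  {v : HeightOneSpectrum (𝓞 K)}

/-- **`p ∣ #(U(c,c) t_v U(c,c) / U(c,c))`** (`1 ≤ c`, as a `Nat.card`). [folklore] -/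
theorem dvd_natCard_doubleCosetQuot_level (h𝒰 : 𝒰.IsMaximalAbove) (hv : (p : 𝓞 K) ∈ v.asIdeal)
    {c : ℕ} (hc : 1 ≤ c) :
    p ∣ Nat.card (ArithmeticQuotient.doubleCosetQuot (𝒰.level c c) (heckeElement 2 K v 1 ^ 1)) := by
  have hL : 𝒰.level c c = 𝒰.hidaLevel c := by
    rw [hidaLevel_eq_level, max_eq_left hc]
  have hfin : (ArithmeticQuotient.doubleCosetQuot (𝒰.hidaLevel c) (heckeElement 2 K v 1)).Finite :=
    finite_orbit_quotient (𝒰.hidaLevel c) (heckeElement 2 K v 1)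
  rw [pow_one, hL, Nat.card_coe_set_eq,
    Set.ncard_eq_toFinset_card (ArithmeticQuotient.doubleCosetQuot (𝒰.hidaLevel c) (heckeElement 2 K v 1)) hfin]
  exact 𝒰.dvd_card_doubleCosetQuot_hidaLevel h𝒰 hv c hfin

omit [Fact p.Prime] in
/-- `(#J · 1)^n = 0` on `ℤ/p^s` if `p ∣ #J` and `s ≤ n`. [folklore] -/
theorem natCast_pow_eq_zero_of_dvd {J : ℕ} (hJ : p ∣ J) {s n : ℕ} (hn : s ≤ n) :
    ((J : Module.End ℤ (modPow ℤ (p : ℤ) s)) ^ n) = 0 := by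
  obtain ⟨d, hd⟩ : (p : ℤ) ^ s ∣ (J : ℤ) ^ n :=
    (pow_dvd_pow_of_dvd (Int.natCast_dvd_natCast.2 hJ) s).trans (pow_dvd_pow _ hn)
  rw [show ((J : Module.End ℤ (modPow ℤ (p : ℤ) s)) ^ n) = ((J ^ n : ℕ) : Module.End ℤ (modPow ℤ (p : ℤ) s))
    from (Nat.cast_pow J n).symm]
  refine LinearMap.ext fun x => ?_
  induction x using Submodule.Quotient.induction_on with
  | H x =>
    rw [Module.End.natCast_apply, LinearMap.zero_apply]
    change (J ^ n) • (Ideal.Quotient.mk (Ideal.span {((p : ℤ) ^ s)}) x) = 0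
    rw [nsmul_eq_mul, ← map_natCast (Ideal.Quotient.mk (Ideal.span {((p : ℤ) ^ s)})), ← map_mul,
      Ideal.Quotient.eq_zero_iff_mem, Nat.cast_pow, hd, mul_assoc]
    exact Ideal.mul_mem_right _ _ (Ideal.mem_span_singleton_self _)

section Induced

variable {b' c : ℕ} [((𝒰.level c c).subgroupOf (𝒰.level b' c)).Normal]
  {N : Type} [AddCommGroup N] [Module ℤ N]
  (ρ : Representation ℤ (𝒰.level b' c ⧸ (𝒰.level c c).subgroupOf (𝒰.level b' c)) N)

/-- **`U^n = 0` on `H⁰(Γ, 𝓕(N))` with trivial `ℤ/p^s`-coefficients** (`n ≥ s`), for the unipotent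
adapted family of `t_v` at the level `U(b', c)`. [cite: Hida1994AIF, §3, proof of Thm 3.2] -/
theorem inducedHeckeCohomology_zero_pow_eq_zero_triv (h𝒰 : 𝒰.IsMaximalAbove) (hv : (p : 𝓞 K) ∈ v.asIdeal)
    (hb' : b' ≤ c) (hc : 1 ≤ c) {Δ : Submonoid (FiniteAdelicGL 2 K)} (hU' : (𝒰.level b' c).toSubmonoid ≤ Δ)
    (hΔ : ∀ j, 𝒰.unipotentFamily (v := v) c 1 j ∈ Δ) (s : ℕ) {n : ℕ} (hn : s ≤ n) :
    inducedHeckeCohomology (globalEmbedding 2 K) (1 : Δ →* Module.End ℤ (modPow ℤ (p : ℤ) s)) hU'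
        (QuotientGroup.mk' ((𝒰.level c c).subgroupOf (𝒰.level b' c))) (ρ := ρ)
        (𝒰.isAdaptedFamily_unipotentFamily h𝒰 hv hc hb' hc hΔ) 0 ^ n = 0 := by
  set j₀ : ArithmeticQuotient.doubleCosetQuot (𝒰.level c c) (heckeElement 2 K v 1 ^ 1) :=
    ⟨_, MulAction.mem_orbit_self _⟩
  refine inducedHeckeCohomology_zero_pow_eq_zero (globalEmbedding 2 K) _ hU' _ ρ _ j₀ ?_ ?_
  · intro F hF hinv g j
    exact 𝒰.apply_mul_unipotentFamily_eq_of_unipotent_trivial (1 : Δ →* Module.End ℤ (modPow ℤ (p : ℤ) s))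
      hU' ρ h𝒰 hv hc hb' (𝒰.isOpen_level c c) le_rfl (fun _ _ => rfl) (fun _ _ => rfl) hF hinv g j j₀
  · -- `B = #J · 1`
    have hB : (∑ j, (1 : Δ →* Module.End ℤ (modPow ℤ (p : ℤ) s))
        ⟨𝒰.unipotentFamily c 1 j, (𝒰.isAdaptedFamily_unipotentFamily h𝒰 hv hc hb' hc hΔ).mem j⟩) =
        (Nat.card (ArithmeticQuotient.doubleCosetQuot (𝒰.level c c) (heckeElement 2 K v 1 ^ 1)) :
          Module.End ℤ (modPow ℤ (p : ℤ) s)) := by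
      simp only [MonoidHom.one_apply, Finset.sum_const, Finset.card_univ, Nat.card_eq_fintype_card,
        nsmul_eq_mul, mul_one]
    rw [hB]
    exact natCast_pow_eq_zero_of_dvd (𝒰.dvd_natCard_doubleCosetQuot_level h𝒰 hv hc) hn

end Induced

/-- **`[U(b',c) t_v U(b',c)]^n = 0` on `H⁰(U(b',c), 1; ℤ/p^s)`** for `n ≥ s` (`b' ≤ c`, `1 ≤ c`,
`v ∣ p`, `U` maximal above `p`). [cite: Hida1994AIF, §3, proof of Thm 3.2] -/
theorem laHecke_zero_pow_eq_zero (h𝒰 : 𝒰.IsMaximalAbove) (hv : (p : 𝓞 K) ∈ v.asIdeal) {b' c : ℕ}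
    (hb' : b' ≤ c) (hc : 1 ≤ c) (s : ℕ) {n : ℕ} (hn : s ≤ n) :
    𝒰.laHecke ℤ b' c s (heckeElement 2 K v 1) 0 ^ n = 0 := by
  haveI := 𝒰.normal_subgroupOf_level h𝒰 hb' hc
  haveI : Fintype (𝒰.level b' c ⧸ (𝒰.level c c).subgroupOf (𝒰.level b' c)) :=
    @Fintype.ofFinite _ (𝒰.finite_quotient_level b' c)
  have ha := 𝒰.isAdaptedFamily_unipotentFamily (v := v) h𝒰 hv hc hb' hc (Δ := ⊤) fun _ => Submonoid.mem_top _
  have hbij := 𝒰.coe_unipotentFamily_bijOn' (v := v) h𝒰 hv (b' := b') (a := 1) hc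
  -- `[U' t U'] ≫ e = e ≫ U^𝓕` for `e = trivRepIso : M(U', 1) ≅ 𝓕(ℤ)`
  have h0 := 𝒰.inducedHeckeCohomology_zero_pow_eq_zero_triv (Representation.trivial ℤ _ ℤ) h𝒰 hv hb' hc
    (le_top : (𝒰.level b' c).toSubmonoid ≤ ⊤) (fun _ => Submonoid.mem_top _) s hn
  have hsq := heckeRepHom_comp_trivRepIso_hom (globalEmbedding 2 K)
    (1 : (⊤ : Submonoid (FiniteAdelicGL 2 K)) →* Module.End ℤ (modPow ℤ (p : ℤ) s))
    (le_top : (𝒰.level b' c).toSubmonoid ≤ ⊤)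
    (QuotientGroup.mk' ((𝒰.level c c).subgroupOf (𝒰.level b' c)))
    (Submonoid.mem_top (heckeElement 2 K v 1 ^ 1)) ha hbij
  generalize (trivRepIso (globalEmbedding 2 K)
    (1 : (⊤ : Submonoid (FiniteAdelicGL 2 K)) →* Module.End ℤ (modPow ℤ (p : ℤ) s))
    (le_top : (𝒰.level b' c).toSubmonoid ≤ ⊤)
    (QuotientGroup.mk' ((𝒰.level c c).subgroupOf (𝒰.level b' c)))) = e at hsq
  -- `e_* ([U' t U'] x) = U^𝓕 (e_* x)` on `H⁰`, hence for the powers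
  have hcomm : ∀ x, (map (MonoidHom.id (GL (Fin 2) K)) e.hom 0).hom
      (𝒰.laHecke ℤ b' c s (heckeElement 2 K v 1 ^ 1) 0 x) =
      inducedHeckeCohomology (globalEmbedding 2 K) _ le_top _ ha (ρ := Representation.trivial ℤ _ ℤ) 0
        ((map (MonoidHom.id (GL (Fin 2) K)) e.hom 0).hom x) := fun x => map_hom_map_hom_eq hsq 0 x
  have hpow := fun x => LevelControl.pow_apply_comp_eq _ _ _ (fun x => (hcomm x).symm) n x
  -- `e` is an isomorphism on cohomology, so `[U' t U']^n = 0`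
  have hid : ∀ y, ((groupCohomology.functor ℤ (GL (Fin 2) K) 0).mapIso e).inv.hom
      (((groupCohomology.functor ℤ (GL (Fin 2) K) 0).mapIso e).hom.hom y) = y := fun y => by
    rw [← LinearMap.comp_apply, ← ModuleCat.hom_comp, Iso.hom_inv_id, ModuleCat.hom_id, LinearMap.id_apply]
  have h1 : 𝒰.laHecke ℤ b' c s (heckeElement 2 K v 1 ^ 1) 0 ^ n = 0 := by
    refine LinearMap.ext fun x => ?_
    have hx := congrArg ((groupCohomology.functor ℤ (GL (Fin 2) K) 0).mapIso e).inv.hom (hpow x)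
    rw [h0, LinearMap.zero_apply] at hx
    have hz : ((groupCohomology.functor ℤ (GL (Fin 2) K) 0).mapIso e).inv.hom 0 = 0 := map_zero _
    rw [LinearMap.zero_apply, ← hid ((𝒰.laHecke ℤ b' c s (heckeElement 2 K v 1 ^ 1) 0 ^ n) x)]
    exact (hz.symm.trans hx).symm
  have hcongr : 𝒰.laHecke ℤ b' c s (heckeElement 2 K v 1) 0 = 𝒰.laHecke ℤ b' c s (heckeElement 2 K v 1 ^ 1) 0 :=
    heckeCohomology_congr (globalEmbedding 2 K) ⊤ _ (𝒰.level b' c) le_top (Submonoid.mem_top _)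
      (Submonoid.mem_top _) (pow_one (heckeElement 2 K v 1)).symm 0
  rw [hcongr]
  exact h1

end TameLevel

end BigHeckeGLn

end Literature.NumberTheory.Automorphic
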